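import Summits.CriticalPhenomena.PercolationContinuityZ3.Theorems.Transplant.FKDoubleFanOneSided
import HarnessLib

/-!
# Double fans, MULTIFAN₁ middles: the piecewise certificate for `CORE4` (the all-roof endpoint polynomial of LEMMA‴), part D6

Helper file (`--supports stmt-CriticalPhenomena-4575`), FK sub-lane `prim-bschramm-fk-3` (gen 34); builds on p205010 (kernel theorem, internal audit
signed; external expert review pending).  Pure real polynomial algebra, no sorries; standard axioms.  Memo `bschramm/prim-bschramm-fk-3/FAR-CROSS-IX.md` §6–§6i.

Context.  `…DoubleFanMultifan` reduces cross-apex negative correlation across every two-sided middle whose `a`-spokes precede its `b`-spokes (every distance,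
every weighted double fan `K₂ ∨ P_n`, `0 < q ≤ 1`) to the four-leg inequality LEMMA‴; its endpoint table (memo §6) consists of tensor-Bernstein cells, zero cells,
closed forms, the two CORE-sized polynomials `𝒞₁, 𝒞₂` (`…MultifanC1Cert*/C2Cert*`) and the all-roof cell `q²(1−q)(2−q)·CORE4`, `CORE4` a polynomial of 1,863 terms in
`q, t_f, w_f, t_g, w_g, t_u, w_u, t_s, w_s` (degree 7 in `q`, ≤ 2 in every other variable).  `CORE4 ≥ 0` on `t ≥ 0`, `q, w ∈ [0,1]` by a PIECEWISE polynomial certificate: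
  `CORE4 = (2−q)·V² + q(2−q)³·[t_s(w_s w_u T − U)² + t_u(w_s w_u T − S)² + T(U+S)²] + Σ_e t_f^{e₁} t_g^{e₂} t_u^{e₃} t_s^{e₄} · R_e(q, w)`,
  `T = t_f + t_g + q t_f t_g`, `U = w_f(w_g − w_s) t_u`, `S = w_g(w_f − w_u) t_s`, `V = (2−q)(w_s w_u T − U − S) + 2(1−q)·m`,
with `m = m_P := w_u w_s(1−w_f) − w_f(w_g−w_s)(1−w_u)` on the region `P = {w_g ≥ w_s}`, `m = m_M := −w_f w_g(1−w_s)(1−w_u)` on `M = {w_s ≥ w_g, w_u ≥ w_f}`, and the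
mirror image `(t_f,w_f,t_u,w_u) ↔ (t_g,w_g,t_s,w_s)` of the P-certificate on `{w_f ≥ w_u}` (CORE4 is mirror-symmetric).  There are 37 non-zero cells `R_e` per region; the
31 cells not involving `m` are common to both regions.  Every cell is `≥ 0` on its region by an explicit certificate — a tensor-Bernstein expansion with non-negative
coefficients, or positive multiples of SQUARE PATTERNS (`(w−w′)²`, `(1−w−w′)²`, `(αw−βw′)²`, `(αw(1−w′)−βw″)²`, `(ww′−w″w‴)²`) times Bernstein elements plus such an
expansion — where the region cells are certified after the box substitutions `w_s = w_g·σ` (P) and `w_f = w_u·φ, w_g = w_s·γ` (M), which map `[0,1]²` onto the region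
(found by linear programming; exact rational vertices; every identity below is checked by `ring`, every sign by `positivity`).  This file: `core4RP0001`.
[folklore]
-/

noncomputable section

namespace Summit.CriticalPhenomena.PercolationContinuityZ3.Theorems

namespace FK

namespace ThreeApex

set_option maxRecDepth 30000 in
set_option maxHeartbeats 16000000 in
/-- CORE4 certificate, region-P remainder cell (m = m_P): coefficient of `t_f^0 t_g^0 t_u^0 t_s^1` in `CORE4 − (2−q)V² − q(2−q)³·cubic` (polynomial in `q, w_f, w_g, w_u, w_s`). [folklore] -/
def core4RP0001 (q wf wg wu ws : ℝ) : ℝ :=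
  ((16 : ℝ) * wf * wg ^ 2 * wu * ws ^ 2 + ((-8) : ℝ) * wf ^ 2 * wg ^ 2 * ws ^ 2 + ((-8) : ℝ) * wf ^ 2 * wg ^ 2 * wu ^ 2 + ((-8) : ℝ) * wg ^ 2 * wu ^ 2 * ws ^ 2 +
    (32 : ℝ) * wf * wg * wu ^ 2 * ws + ((-16) : ℝ) * wf * wg ^ 2 * wu ^ 2 + ((-32) : ℝ) * wf ^ 2 * wg * wu * ws + (16 : ℝ) * wf ^ 2 * wg ^ 2 * wu +
    ((-16) : ℝ) * wf * wg * wu * ws + (16 : ℝ) * wf ^ 2 * wg * ws + (8 : ℝ) * wg ^ 2 * wu ^ 2) + q * (((-8) : ℝ) * wf ^ 2 * wg ^ 2 * wu ^ 2 * ws ^ 2 +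
    (8 : ℝ) * wf * wg ^ 2 * wu ^ 2 * ws ^ 2 + (8 : ℝ) * wf ^ 2 * wg ^ 2 * wu * ws ^ 2 + ((-32) : ℝ) * wf * wg ^ 2 * wu * ws ^ 2 + (16 : ℝ) * wf ^ 2 * wg * wu ^ 2 * ws +
    (12 : ℝ) * wf ^ 2 * wg ^ 2 * ws ^ 2 + (20 : ℝ) * wf ^ 2 * wg ^ 2 * wu ^ 2 + ((-8) : ℝ) * wf ^ 2 * wu ^ 2 * ws ^ 2 + (4 : ℝ) * wg ^ 2 * wu ^ 2 * ws ^ 2 +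
    ((-72) : ℝ) * wf * wg * wu ^ 2 * ws + ((-8) : ℝ) * wf * wg * wu * ws ^ 2 + ((-8) : ℝ) * wf * wg ^ 2 * wu * ws + (24 : ℝ) * wf * wg ^ 2 * wu ^ 2 +
    (56 : ℝ) * wf ^ 2 * wg * wu * ws + ((-40) : ℝ) * wf ^ 2 * wg ^ 2 * wu + (8 : ℝ) * wg * wu ^ 2 * ws ^ 2 + (8 : ℝ) * wg ^ 2 * wu ^ 2 * ws + (32 : ℝ) * wf * wg * wu * ws +
    (16 : ℝ) * wf * wu * ws ^ 2 + ((-32) : ℝ) * wf ^ 2 * wg * ws + (8 : ℝ) * wf ^ 2 * wg ^ 2 + ((-12) : ℝ) * wg ^ 2 * wu ^ 2) +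
    q ^ 2 * (((-8) : ℝ) * wf * wg ^ 2 * wu ^ 2 * ws ^ 2 + (8 : ℝ) * wf ^ 2 * wg * wu ^ 2 * ws ^ 2 + (8 : ℝ) * wf ^ 2 * wg ^ 2 * wu ^ 2 * ws +
    ((-8) : ℝ) * wf ^ 2 * wg ^ 2 * wu * ws ^ 2 + ((-4) : ℝ) * wf * wg * wu ^ 2 * ws ^ 2 + ((-4) : ℝ) * wf * wg ^ 2 * wu ^ 2 * ws + (32 : ℝ) * wf * wg ^ 2 * wu * ws ^ 2 +
    ((-20) : ℝ) * wf ^ 2 * wg * wu ^ 2 * ws + ((-4) : ℝ) * wf ^ 2 * wg * wu * ws ^ 2 + ((-4) : ℝ) * wf ^ 2 * wg ^ 2 * wu * ws + ((-6) : ℝ) * wf ^ 2 * wg ^ 2 * ws ^ 2 +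
    ((-14) : ℝ) * wf ^ 2 * wg ^ 2 * wu ^ 2 + (4 : ℝ) * wf ^ 2 * wu ^ 2 * ws ^ 2 + (2 : ℝ) * wg ^ 2 * wu ^ 2 * ws ^ 2 + (48 : ℝ) * wf * wg * wu ^ 2 * ws +
    (8 : ℝ) * wf * wg * wu * ws ^ 2 + (8 : ℝ) * wf * wg ^ 2 * wu * ws + ((-12) : ℝ) * wf * wg ^ 2 * wu ^ 2 + (8 : ℝ) * wf * wu ^ 2 * ws ^ 2 + ((-32) : ℝ) * wf ^ 2 * wg * wu * ws +
    (28 : ℝ) * wf ^ 2 * wg ^ 2 * wu + (8 : ℝ) * wf ^ 2 * wu * ws ^ 2 + ((-8) : ℝ) * wg * wu ^ 2 * ws ^ 2 + ((-8) : ℝ) * wg ^ 2 * wu ^ 2 * ws + ((-16) : ℝ) * wf * wg * wu * ws +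
    ((-32) : ℝ) * wf * wu * ws ^ 2 + (20 : ℝ) * wf ^ 2 * wg * ws + ((-8) : ℝ) * wf ^ 2 * wg ^ 2 + (6 : ℝ) * wg ^ 2 * wu ^ 2) +
    q ^ 3 * (((-2) : ℝ) * wf ^ 2 * wg ^ 2 * wu ^ 2 * ws ^ 2 + (8 : ℝ) * wf * wg ^ 2 * wu ^ 2 * ws ^ 2 + ((-2) : ℝ) * wf ^ 2 * wg * wu ^ 2 * ws ^ 2 +
    ((-2) : ℝ) * wf ^ 2 * wg ^ 2 * wu ^ 2 * ws + (8 : ℝ) * wf ^ 2 * wg ^ 2 * wu * ws ^ 2 + ((-20) : ℝ) * wf * wg ^ 2 * wu * ws ^ 2 + (4 : ℝ) * wf ^ 2 * wg * wu ^ 2 * ws +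
    (1 : ℝ) * wf ^ 2 * wg ^ 2 * ws ^ 2 + (3 : ℝ) * wf ^ 2 * wg ^ 2 * wu ^ 2 + (2 : ℝ) * wf ^ 2 * wu ^ 2 * ws ^ 2 + ((-1) : ℝ) * wg ^ 2 * wu ^ 2 * ws ^ 2 +
    ((-8) : ℝ) * wf * wg * wu ^ 2 * ws + (2 : ℝ) * wf * wg ^ 2 * wu ^ 2 + ((-8) : ℝ) * wf * wu ^ 2 * ws ^ 2 + (8 : ℝ) * wf ^ 2 * wg * wu * ws + ((-6) : ℝ) * wf ^ 2 * wg ^ 2 * wu +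
    ((-8) : ℝ) * wf ^ 2 * wu * ws ^ 2 + (2 : ℝ) * wg * wu ^ 2 * ws ^ 2 + (2 : ℝ) * wg ^ 2 * wu ^ 2 * ws + (20 : ℝ) * wf * wu * ws ^ 2 + ((-4) : ℝ) * wf ^ 2 * wg * ws +
    (2 : ℝ) * wf ^ 2 * wg ^ 2 + ((-1) : ℝ) * wg ^ 2 * wu ^ 2) + q ^ 4 * ((1 : ℝ) * wf ^ 2 * wg ^ 2 * wu ^ 2 * ws ^ 2 + ((-2) : ℝ) * wf * wg ^ 2 * wu ^ 2 * ws ^ 2 +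
    ((-2) : ℝ) * wf ^ 2 * wg ^ 2 * wu * ws ^ 2 + (4 : ℝ) * wf * wg ^ 2 * wu * ws ^ 2 + ((-1) : ℝ) * wf ^ 2 * wu ^ 2 * ws ^ 2 + (2 : ℝ) * wf * wu ^ 2 * ws ^ 2 +
    (2 : ℝ) * wf ^ 2 * wu * ws ^ 2 + ((-4) : ℝ) * wf * wu * ws ^ 2)

set_option maxRecDepth 30000 in
set_option maxHeartbeats 16000000 in
/-- `core4RP0001 ≥ 0` on the box after the region-P substitution `w_s = w_g·σ` (`σ = sg ∈ [0,1]`, i.e. `w_s ≤ w_g`): 17 positive multiples of square patterns times Bernstein elements plus a tensor-Bernstein expansion with non-negative coefficients (nested Horner-by-variable form; found by LP, exact rational vertex). [folklore] -/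
theorem core4RP0001_nonneg_sub {q wf wg wu sg : ℝ} (hq0 : 0 ≤ q) (hq1 : q ≤ 1) (hwf0 : 0 ≤ wf) (hwf1 : wf ≤ 1) (hwg0 : 0 ≤ wg) (hwg1 : wg ≤ 1) (hwu0 : 0 ≤ wu) (hwu1 : wu ≤ 1) (hsg0 : 0 ≤ sg) (hsg1 : sg ≤ 1) :
    0 ≤ core4RP0001 q wf wg wu (wg * sg) := by
  have hq1' : (0:ℝ) ≤ 1 - q := sub_nonneg.2 hq1
  have hwf1' : (0:ℝ) ≤ 1 - wf := sub_nonneg.2 hwf1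
  have hwg1' : (0:ℝ) ≤ 1 - wg := sub_nonneg.2 hwg1
  have hwu1' : (0:ℝ) ≤ 1 - wu := sub_nonneg.2 hwu1
  have hsg1' : (0:ℝ) ≤ 1 - sg := sub_nonneg.2 hsg1
  have e : core4RP0001 q wf wg wu (wg * sg) =
      (8 : ℝ) * (wf - wu) ^ 2 * (1 - q) ^ 4 * wg ^ 2 * (1 - wg) ^ 2 * sg * (1 - sg) + (8 : ℝ) * (wf - wu) ^ 2 * (1 - q) ^ 4 * wg ^ 2 * (1 - wg) ^ 2 * sg ^ 2 +
      (16 : ℝ) * (wf - wu) ^ 2 * (1 - q) ^ 4 * wg ^ 3 * (1 - wg) * sg * (1 - sg) + (16 : ℝ) * (wf - wu) ^ 2 * (1 - q) ^ 4 * wg ^ 3 * (1 - wg) * sg ^ 2 +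
      (8 : ℝ) * (wf - wu) ^ 2 * (1 - q) ^ 4 * wg ^ 4 * sg * (1 - sg) + (16 : ℝ) * (wf - wu) ^ 2 * q * (1 - q) ^ 3 * wg ^ 2 * (1 - wg) ^ 2 * sg * (1 - sg) +
      (8 : ℝ) * (wf - wu) ^ 2 * q * (1 - q) ^ 3 * wg ^ 2 * (1 - wg) ^ 2 * sg ^ 2 + (36 : ℝ) * (wf - wu) ^ 2 * q * (1 - q) ^ 3 * wg ^ 3 * (1 - wg) * sg * (1 - sg) +
      (24 : ℝ) * (wf - wu) ^ 2 * q * (1 - q) ^ 3 * wg ^ 3 * (1 - wg) * sg ^ 2 + (20 : ℝ) * (wf - wu) ^ 2 * q * (1 - q) ^ 3 * wg ^ 4 * sg * (1 - sg) +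
      (8 : ℝ) * (wf - wu) ^ 2 * q ^ 2 * (1 - q) ^ 2 * wg ^ 2 * (1 - wg) ^ 2 * sg * (1 - sg) + (24 : ℝ) * (wf - wu) ^ 2 * q ^ 2 * (1 - q) ^ 2 * wg ^ 3 * (1 - wg) * sg * (1 - sg) +
      (16 : ℝ) * (wf - wu) ^ 2 * q ^ 2 * (1 - q) ^ 2 * wg ^ 3 * (1 - wg) * sg ^ 2 + (16 : ℝ) * (wf - wu) ^ 2 * q ^ 2 * (1 - q) ^ 2 * wg ^ 4 * sg * (1 - sg) +
      (4 : ℝ) * (wf - wu) ^ 2 * q ^ 3 * (1 - q) * wg ^ 3 * (1 - wg) * sg * (1 - sg) + (4 : ℝ) * (wf - wu) ^ 2 * q ^ 3 * (1 - q) * wg ^ 3 * (1 - wg) * sg ^ 2 +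
      (4 : ℝ) * (wf - wu) ^ 2 * q ^ 3 * (1 - q) * wg ^ 4 * sg * (1 - sg) + (1 - q) ^ 4 * ((1 - wf) ^ 2 * (wg ^ 2 * (1 - wg) ^ 2 * (wu ^ 2 * ((8 : ℝ) * (1 - sg) ^ 2 +
      (8 : ℝ) * sg * (1 - sg))) + wg ^ 3 * (1 - wg) * (wu ^ 2 * ((16 : ℝ) * (1 - sg) ^ 2 + (16 : ℝ) * sg * (1 - sg))) + wg ^ 4 * (wu ^ 2 * ((8 : ℝ) * (1 - sg) ^ 2 +
      (8 : ℝ) * sg * (1 - sg)))) + wf * (1 - wf) * (wg ^ 2 * (1 - wg) ^ 2 * (wu ^ 2 * ((16 : ℝ) * sg * (1 - sg) + (16 : ℝ) * sg ^ 2)) +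
      wg ^ 3 * (1 - wg) * (wu ^ 2 * ((32 : ℝ) * sg * (1 - sg) + (32 : ℝ) * sg ^ 2)) + wg ^ 4 * (wu ^ 2 * ((16 : ℝ) * sg * (1 - sg) + (16 : ℝ) * sg ^ 2))) +
      wf ^ 2 * (wg ^ 2 * (1 - wg) ^ 2 * ((1 - wu) ^ 2 * ((8 : ℝ) * sg * (1 - sg) + (8 : ℝ) * sg ^ 2) + wu * (1 - wu) * ((16 : ℝ) * (1 - sg) ^ 2 + (16 : ℝ) * sg * (1 - sg))) +
      wg ^ 3 * (1 - wg) * ((1 - wu) ^ 2 * ((16 : ℝ) * sg * (1 - sg) + (16 : ℝ) * sg ^ 2) + wu * (1 - wu) * ((32 : ℝ) * (1 - sg) ^ 2 + (32 : ℝ) * sg * (1 - sg))) +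
      wg ^ 4 * ((1 - wu) ^ 2 * ((8 : ℝ) * sg * (1 - sg) + (8 : ℝ) * sg ^ 2) + wu * (1 - wu) * ((16 : ℝ) * (1 - sg) ^ 2 + (16 : ℝ) * sg * (1 - sg))))) +
      q * (1 - q) ^ 3 * ((1 - wf) ^ 2 * (wg ^ 2 * (1 - wg) ^ 2 * (wu ^ 2 * ((20 : ℝ) * (1 - sg) ^ 2 + (24 : ℝ) * sg * (1 - sg) + (12 : ℝ) * sg ^ 2)) +
      wg ^ 3 * (1 - wg) * (wu ^ 2 * ((40 : ℝ) * (1 - sg) ^ 2 + (52 : ℝ) * sg * (1 - sg) + (32 : ℝ) * sg ^ 2)) + wg ^ 4 * (wu ^ 2 * ((20 : ℝ) * (1 - sg) ^ 2 +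
      (28 : ℝ) * sg * (1 - sg) + (8 : ℝ) * sg ^ 2))) + wf * (1 - wf) * (wg ^ 2 * (1 - wg) ^ 2 * (wu ^ 2 * ((24 : ℝ) * sg * (1 - sg) + (40 : ℝ) * sg ^ 2)) +
      wg ^ 3 * (1 - wg) * (wu ^ 2 * ((56 : ℝ) * sg * (1 - sg) + (96 : ℝ) * sg ^ 2)) + wg ^ 4 * (wu ^ 2 * ((32 : ℝ) * sg * (1 - sg) + (40 : ℝ) * sg ^ 2))) +
      wf ^ 2 * (wg ^ 2 * (1 - wg) ^ 2 * ((1 - wu) ^ 2 * ((8 : ℝ) * (1 - sg) ^ 2 + (32 : ℝ) * sg * (1 - sg) + (32 : ℝ) * sg ^ 2) + wu * (1 - wu) * ((40 : ℝ) * (1 - sg) ^ 2 +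
      (40 : ℝ) * sg * (1 - sg) + (16 : ℝ) * sg ^ 2) + wu ^ 2 * ((8 : ℝ) * sg ^ 2)) + wg ^ 3 * (1 - wg) * ((1 - wu) ^ 2 * ((16 : ℝ) * (1 - sg) ^ 2 + (60 : ℝ) * sg * (1 - sg) +
      (56 : ℝ) * sg ^ 2) + wu * (1 - wu) * ((80 : ℝ) * (1 - sg) ^ 2 + (72 : ℝ) * sg * (1 - sg) + (16 : ℝ) * sg ^ 2) + wu ^ 2 * ((16 : ℝ) * sg ^ 2)) +
      wg ^ 4 * ((1 - wu) ^ 2 * ((8 : ℝ) * (1 - sg) ^ 2 + (28 : ℝ) * sg * (1 - sg) + (20 : ℝ) * sg ^ 2) + wu * (1 - wu) * ((40 : ℝ) * (1 - sg) ^ 2 + (32 : ℝ) * sg * (1 - sg))))) +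
      q ^ 2 * (1 - q) ^ 2 * ((1 - wf) ^ 2 * (wg ^ 2 * (1 - wg) ^ 2 * (wu ^ 2 * ((18 : ℝ) * (1 - sg) ^ 2 + (28 : ℝ) * sg * (1 - sg) + (18 : ℝ) * sg ^ 2)) +
      wg ^ 3 * (1 - wg) * (wu ^ 2 * ((36 : ℝ) * (1 - sg) ^ 2 + (64 : ℝ) * sg * (1 - sg) + (52 : ℝ) * sg ^ 2)) + wg ^ 4 * (wu ^ 2 * ((18 : ℝ) * (1 - sg) ^ 2 +
      (36 : ℝ) * sg * (1 - sg) + (16 : ℝ) * sg ^ 2))) + wf * (1 - wf) * (wg ^ 2 * (1 - wg) ^ 2 * (wu ^ 2 * ((8 : ℝ) * sg * (1 - sg) + (32 : ℝ) * sg ^ 2)) +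
      wg ^ 3 * (1 - wg) * (wu ^ 2 * ((28 : ℝ) * sg * (1 - sg) + (88 : ℝ) * sg ^ 2)) + wg ^ 4 * (wu ^ 2 * ((20 : ℝ) * sg * (1 - sg) + (36 : ℝ) * sg ^ 2))) +
      wf ^ 2 * (wg ^ 2 * (1 - wg) ^ 2 * ((1 - wu) ^ 2 * ((16 : ℝ) * (1 - sg) ^ 2 + (44 : ℝ) * sg * (1 - sg) + (36 : ℝ) * sg ^ 2) + wu * (1 - wu) * ((36 : ℝ) * (1 - sg) ^ 2 +
      (40 : ℝ) * sg * (1 - sg) + (28 : ℝ) * sg ^ 2) + wu ^ 2 * ((12 : ℝ) * sg ^ 2)) + wg ^ 3 * (1 - wg) * ((1 - wu) ^ 2 * ((32 : ℝ) * (1 - sg) ^ 2 + (80 : ℝ) * sg * (1 - sg) +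
      (56 : ℝ) * sg ^ 2) + wu * (1 - wu) * ((72 : ℝ) * (1 - sg) ^ 2 + (60 : ℝ) * sg * (1 - sg) + (16 : ℝ) * sg ^ 2) + wu ^ 2 * ((24 : ℝ) * sg ^ 2)) +
      wg ^ 4 * ((1 - wu) ^ 2 * ((16 : ℝ) * (1 - sg) ^ 2 + (36 : ℝ) * sg * (1 - sg) + (18 : ℝ) * sg ^ 2) + wu * (1 - wu) * ((36 : ℝ) * (1 - sg) ^ 2 + (20 : ℝ) * sg * (1 - sg))))) +
      q ^ 3 * (1 - q) * ((1 - wf) ^ 2 * (wg ^ 2 * (1 - wg) ^ 2 * (wu ^ 2 * ((7 : ℝ) * (1 - sg) ^ 2 + (14 : ℝ) * sg * (1 - sg) + (7 : ℝ) * sg ^ 2)) +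
      wg ^ 3 * (1 - wg) * (wu ^ 2 * ((14 : ℝ) * (1 - sg) ^ 2 + (34 : ℝ) * sg * (1 - sg) + (30 : ℝ) * sg ^ 2)) + wg ^ 4 * (wu ^ 2 * ((7 : ℝ) * (1 - sg) ^ 2 +
      (20 : ℝ) * sg * (1 - sg) + (10 : ℝ) * sg ^ 2))) + wf * (1 - wf) * (wg ^ 2 * (1 - wg) ^ 2 * (wu * (1 - wu) * ((4 : ℝ) * sg ^ 2) + wu ^ 2 * ((12 : ℝ) * sg ^ 2)) +
      wg ^ 3 * (1 - wg) * (wu ^ 2 * ((4 : ℝ) * sg * (1 - sg) + (32 : ℝ) * sg ^ 2)) + wg ^ 4 * (wu ^ 2 * ((4 : ℝ) * sg * (1 - sg) + (14 : ℝ) * sg ^ 2))) +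
      wf ^ 2 * (wg ^ 2 * (1 - wg) ^ 2 * ((1 - wu) ^ 2 * ((10 : ℝ) * (1 - sg) ^ 2 + (24 : ℝ) * sg * (1 - sg) + (14 : ℝ) * sg ^ 2) + wu * (1 - wu) * ((14 : ℝ) * (1 - sg) ^ 2 +
      (20 : ℝ) * sg * (1 - sg) + (18 : ℝ) * sg ^ 2) + wu ^ 2 * ((6 : ℝ) * sg ^ 2)) + wg ^ 3 * (1 - wg) * ((1 - wu) ^ 2 * ((20 : ℝ) * (1 - sg) ^ 2 + (44 : ℝ) * sg * (1 - sg) +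
      (24 : ℝ) * sg ^ 2) + wu * (1 - wu) * ((28 : ℝ) * (1 - sg) ^ 2 + (24 : ℝ) * sg * (1 - sg) + (4 : ℝ) * sg ^ 2) + wu ^ 2 * ((12 : ℝ) * sg ^ 2)) +
      wg ^ 4 * ((1 - wu) ^ 2 * ((10 : ℝ) * (1 - sg) ^ 2 + (20 : ℝ) * sg * (1 - sg) + (7 : ℝ) * sg ^ 2) + wu * (1 - wu) * ((14 : ℝ) * (1 - sg) ^ 2 + (4 : ℝ) * sg * (1 - sg))))) +
      q ^ 4 * ((1 - wf) ^ 2 * (wg ^ 2 * (1 - wg) ^ 2 * (wu ^ 2 * ((1 : ℝ) * (1 - sg) ^ 2 + (2 : ℝ) * sg * (1 - sg) + (1 : ℝ) * sg ^ 2)) +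
      wg ^ 3 * (1 - wg) * (wu ^ 2 * ((2 : ℝ) * (1 - sg) ^ 2 + (6 : ℝ) * sg * (1 - sg) + (6 : ℝ) * sg ^ 2)) + wg ^ 4 * (wu ^ 2 * ((1 : ℝ) * (1 - sg) ^ 2 + (4 : ℝ) * sg * (1 - sg) +
      (2 : ℝ) * sg ^ 2))) + wf * (1 - wf) * (wg ^ 2 * (1 - wg) ^ 2 * (wu ^ 2 * ((2 : ℝ) * sg ^ 2)) + wg ^ 3 * (1 - wg) * (wu ^ 2 * ((4 : ℝ) * sg ^ 2)) +
      wg ^ 4 * (wu ^ 2 * ((2 : ℝ) * sg ^ 2))) + wf ^ 2 * (wg ^ 2 * (1 - wg) ^ 2 * ((1 - wu) ^ 2 * ((2 : ℝ) * (1 - sg) ^ 2 + (4 : ℝ) * sg * (1 - sg) + (2 : ℝ) * sg ^ 2) +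
      wu * (1 - wu) * ((2 : ℝ) * (1 - sg) ^ 2 + (4 : ℝ) * sg * (1 - sg) + (4 : ℝ) * sg ^ 2) + wu ^ 2 * ((1 : ℝ) * sg ^ 2)) +
      wg ^ 3 * (1 - wg) * ((1 - wu) ^ 2 * ((4 : ℝ) * (1 - sg) ^ 2 + (8 : ℝ) * sg * (1 - sg) + (4 : ℝ) * sg ^ 2) + wu * (1 - wu) * ((4 : ℝ) * (1 - sg) ^ 2 +
      (4 : ℝ) * sg * (1 - sg)) + wu ^ 2 * ((2 : ℝ) * sg ^ 2)) + wg ^ 4 * ((1 - wu) ^ 2 * ((2 : ℝ) * (1 - sg) ^ 2 + (4 : ℝ) * sg * (1 - sg) + (1 : ℝ) * sg ^ 2) +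
      wu * (1 - wu) * ((2 : ℝ) * (1 - sg) ^ 2)))) := by
    simp only [core4RP0001]; ring
  rw [e]; positivity

/-- `core4RP0001 ≥ 0` on the region `P = {w_s ≤ w_g}` of the box (from `core4RP0001_nonneg_sub` with `σ = w_s / w_g`; the corner `w_g = 0` forces `w_s = 0`). [folklore] -/
theorem core4RP0001_nonneg_P {q wf wg wu ws : ℝ} (hq0 : 0 ≤ q) (hq1 : q ≤ 1) (hwf0 : 0 ≤ wf) (hwf1 : wf ≤ 1) (hwg0 : 0 ≤ wg) (hwg1 : wg ≤ 1)
    (hwu0 : 0 ≤ wu) (hwu1 : wu ≤ 1) (hws0 : 0 ≤ ws) (hsg : ws ≤ wg) : 0 ≤ core4RP0001 q wf wg wu ws := by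
  rcases eq_or_lt_of_le hwg0 with h0 | hpos
  · have hs : ws = 0 := le_antisymm (by linarith) hws0
    have key := core4RP0001_nonneg_sub (q := q) (wf := wf) (wg := wg) (wu := wu) (sg := 0) hq0 hq1 hwf0 hwf1 hwg0 hwg1 hwu0 hwu1 le_rfl zero_le_one
    simpa [hs] using key
  · have hsg0 : 0 ≤ ws / wg := div_nonneg hws0 hwg0
    have hsg1 : ws / wg ≤ 1 := by rw [div_le_one hpos]; exact hsg
    have key := core4RP0001_nonneg_sub (q := q) (wf := wf) (wg := wg) (wu := wu) (sg := ws / wg) hq0 hq1 hwf0 hwf1 hwg0 hwg1 hwu0 hwu1 hsg0 hsg1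
    have hne : wg ≠ 0 := ne_of_gt hpos
    have hm : wg * (ws / wg) = ws := by field_simp
    rwa [hm] at key

end ThreeApex

end FK

end Summit.CriticalPhenomena.PercolationContinuityZ3.Theorems
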